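import Summits.Ventures.PercRepro.PuncturedLYMCoHypMain
import Summits.Ventures.PercRepro.PuncturedLYMRestrict

/-!
# PercRepro — ONE CO-HYPERPLANE OF ANY SIZE ON AN ARBITRARY GROUND FINSET: (SP) FOR THE `j`-SUBSETS OF `E`
CONTAINING A SET `C` (p10, gen 34)

PuncturedLYMCoHypMain proved `puncturedNMP_upLevel` on a finite TYPE (`E = univ`).  Here the statement is transferred
to an arbitrary ground finset `E` through the subtype dictionary of PuncturedLYMRestrict, exactly as gen 31 transferred
(SP) for codes — but the transfer never used the code hypothesis, only that every member of the family lies in `E`: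
* `upLevelIn j E C` — the `j`-subsets of `E` containing `C`; `image_toSub_upLevelIn` — its image on the subtype of `E`
  is `upLevel j (toSub E C)`;
* `image_toSub_puncturedIn'`, `puncturedNMP_in_of_subtype'` — the gen-31 transfer for ANY family of subsets of `E`;
* **`puncturedNMP_in_upLevel`** — **(SP) inside `E` for the `j`-subsets of `E` containing `C`**, for every `C ⊆ E` with
  `1 ≤ #C ≤ j` and `2j + 1 ≤ #E`.
Nothing here asserts (SP), (PAV) or (NC) in general.
-/

namespace PercRepro.PuncturedLYM

open Finset

variable {α : Type} [DecidableEq α]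

/-- The `j`-subsets of `E` containing `C`. -/
def upLevelIn (j : ℕ) (E C : Finset α) : Finset (Finset α) :=
  (E.powersetCard j).filter (fun X => C ⊆ X)

/-- Membership in `upLevelIn`. -/
theorem mem_upLevelIn {j : ℕ} {E C X : Finset α} : X ∈ upLevelIn j E C ↔ (X ⊆ E ∧ X.card = j) ∧ C ⊆ X := by
  simp [upLevelIn, mem_filter, mem_powersetCard]

/-- Every member of `upLevelIn j E C` lies in `E`. -/
theorem subset_of_mem_upLevelIn {j : ℕ} {E C X : Finset α} (hX : X ∈ upLevelIn j E C) : X ⊆ E :=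
  (mem_upLevelIn.1 hX).1.1

/-- The image of `upLevelIn j E C` on the subtype of `E` is `upLevel j (toSub E C)` (`C ⊆ E`). -/
theorem image_toSub_upLevelIn {j : ℕ} {E C : Finset α} (hC : C ⊆ E) :
    (upLevelIn j E C).image (toSub E) = upLevel j (toSub E C) := by
  ext X'
  simp only [mem_image, mem_upLevelIn, mem_upLevel]
  constructor
  · rintro ⟨X, ⟨⟨hXE, hXc⟩, hCX⟩, rfl⟩
    exact ⟨by rw [card_toSub hXE, hXc], toSub_subset_toSub hCX⟩
  · rintro ⟨hc, hCX'⟩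
    refine ⟨ofSub E X', ⟨⟨ofSub_subset E X', by rw [card_ofSub, hc]⟩, ?_⟩, toSub_ofSub X'⟩
    rw [← ofSub_toSub hC]
    exact ofSub_subset_ofSub hCX'

/-- The punctured level inside `E` maps onto the punctured level of the image family — for ANY family of subsets of
`E` (the code hypothesis of gen 31 is not needed). -/
theorem image_toSub_puncturedIn' {j : ℕ} {E : Finset α} {D : Finset (Finset α)} (hD : ∀ B ∈ D, B ⊆ E) :
    (puncturedIn j E D).image (toSub E) = punctured j (D.image (toSub E)) := by
  ext X'
  simp only [mem_image, puncturedIn, mem_sdiff, mem_powersetCard, mem_punctured]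
  constructor
  · rintro ⟨X, ⟨⟨hXE, hXc⟩, hXD⟩, rfl⟩
    refine ⟨by rw [card_toSub hXE, hXc], ?_⟩
    rintro ⟨B, hB, hBX⟩
    apply hXD
    have : B = X := by
      rw [← ofSub_toSub (hD B hB), ← ofSub_toSub hXE, hBX]
    exact this ▸ hB
  · rintro ⟨hc, hX'D⟩
    refine ⟨ofSub E X', ⟨⟨ofSub_subset E X', by rw [card_ofSub, hc]⟩, ?_⟩, toSub_ofSub X'⟩
    intro hX
    exact hX'D ⟨ofSub E X', hX, toSub_ofSub X'⟩

/-- **(SP) inside `E` from (SP) for the image family on the subtype** — for ANY family of subsets of `E`. -/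
theorem puncturedNMP_in_of_subtype' {j : ℕ} {E : Finset α} {D : Finset (Finset α)} (hD : ∀ B ∈ D, B ⊆ E)
    (h : PuncturedNMP j (D.image (toSub E))) : PuncturedNMPIn j E D := by
  intro 𝒜 h𝒜
  have h𝒜E : ∀ X ∈ 𝒜, X ⊆ E := fun X hX => (mem_powersetCard.1 (mem_sdiff.1 (h𝒜 hX)).1).1
  have hPE : ∀ X ∈ puncturedIn j E D, X ⊆ E := fun X hX => (mem_powersetCard.1 (mem_sdiff.1 hX).1).1
  have hNE : ∀ Y ∈ upNbhdIn j E 𝒜, Y ⊆ E := fun Y hY => (mem_powersetCard.1 (mem_filter.1 hY).1).1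
  have hinj : ∀ (S : Finset (Finset α)), (∀ X ∈ S, X ⊆ E) → (S.image (toSub E)).card = S.card := by
    intro S hS
    apply card_image_of_injOn
    intro X hX Y hY hXY
    exact toSub_injOn E (by rw [mem_coe, mem_powerset]; exact hS X hX)
      (by rw [mem_coe, mem_powerset]; exact hS Y hY) hXY
  have hsub : 𝒜.image (toSub E) ⊆ punctured j (D.image (toSub E)) := by
    rw [← image_toSub_puncturedIn' hD]
    exact image_subset_image h𝒜
  have key := h (𝒜.image (toSub E)) hsub
  rw [hinj 𝒜 h𝒜E, ← image_toSub_upNbhdIn h𝒜E, ← image_toSub_puncturedIn' hD, hinj _ hNE, hinj _ hPE] at key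
  have hY : (levelAbove {x // x ∈ E} j).card = E.card.choose (j + 1) := by
    rw [card_levelAbove_eq, Fintype.card_coe]
  rw [hY] at key
  exact key

/-- **THE ONE-CO-HYPERPLANE THEOREM INSIDE `E`**: the `j`-subsets of `E` not containing `C` have the normalised
matching property against the `(j+1)`-subsets of `E`, for every `C ⊆ E` with `1 ≤ #C ≤ j` and `2j + 1 ≤ #E`. -/
theorem puncturedNMP_in_upLevel {j : ℕ} {E C : Finset α} (hC : C ⊆ E) (hm : 1 ≤ C.card) (hmj : C.card ≤ j)
    (hn : 2 * j + 1 ≤ E.card) : PuncturedNMPIn j E (upLevelIn j E C) := by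
  apply puncturedNMP_in_of_subtype' (fun B hB => subset_of_mem_upLevelIn hB)
  rw [image_toSub_upLevelIn hC]
  apply puncturedNMP_upLevel
  · rw [card_toSub hC]
    exact hm
  · rw [card_toSub hC]
    exact hmj
  · rw [Fintype.card_coe]
    exact hn

end PercRepro.PuncturedLYM
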